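import Summits.QuantumFields.YangMills.Theorems.BalabanUVNodesN07DeltaPiOfRecordPairing
import Summits.QuantumFields.YangMills.Theorems.BalabanUVNodesN07LinearisedAveragingKernel
import Literature.MathematicalPhysics.QuantumFieldTheory.Balaban1983to89.Node00.BgGaugeLetterOfRecord
import Literature.MathematicalPhysics.QuantumFieldTheory.Balaban1983to89.B9Eq3119DeltaPiReality
import HarnessLib

/-!
# NODE N07 — [B9] p. 392 «for U with values in the unitary group it is a hermitian operator» AT THE RECORD, AS REALITY: def-Y's HILBERT-LEVEL LETTERS OF RECORD
# `Δ(U₀)`, `D_{U₀}`, `D*_{U₀}`, `Δ_{U₀} = D*D` (sites), `Q′♭`, `R = R(U₀; Q′♭)` COMMUTE WITH THE FIBREWISE INVOLUTION `A ↦ Aᴴ` (`starW (phiRec N)`) AT EVERY `SU(N)` BACKGROUND,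
# AND SO DOES THE PINNED AVERAGING `Q(U₀)` AT EVERY GUARDED ONE

Cell `pub-ymgap`, width seat `pub-ymgap-dag-n07-w3` (g26), INTENT-1 ∕ CLAIM-1.  `--kind proof --supports stmt-QuantumFields-27238 --as helper`; count-neutral.
[B9] = [Balaban1985BackgroundPropagators]; [15] = [Balaban1985Variational].

WHY.  3g′ (✓`Node00.BgSchemeOfRecord`) reads its instance with the token `HessSymmTok Δ2 := (Δ(U₀) + Δ2).IsSymmetric`; for THE (3.134) datum `Δ2` (which
`Delta2Tok ∧ Delta2SymmTok` determine uniquely, ✓`N07Delta2OfRecordUnique.eq_of_delta2Tok_of_delta2SymmTok`) that token is EXACTLY the REALITY of `Δ2`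
(✓`hessSymmTok_of_delta2SymmTok_of_starW_comm`), and the reality of `Δ2` is that of the letters entering (3.134): Sect. C's `H♭ = G₁Q*(QG₁Q*)⁻¹` at the flat
site letter, the current `J(U₀)` (Hermitian bondwise, def-Y ✓`star_JOfRecordAtBg_apply`) and `C^{𝔰𝔩}`.  This file is the first, linear half of that reality
programme: the record's elementary operators are REAL.  Lit carries the same calculus at the `fineP`∕tower letters (`B9Eq3119DeltaPiReality` §2,
`B9Eq326OperatorTowerReality`); here it is written at def-Y's record letters (`Node00.BgLettersOfRecord`, `BgGaugeLetterOfRecord`), whose carrier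
`Bond (F.P K).d (fun _ ↦ (F.P K).sitesPerDir 0)` and transporters `RRec ∕ SRec` are not syntactically lit's.

CONTENTS (every `U₀ : GaugeField (F.P K) 0 (SU N)`; no guard; `⋆ := starW (phiRec N)`, `(A⋆)(b) = A(b)ᴴ`).
* §1 generic: ★`real_of_isSymmetric_of_tpair_comm` — an operator on a `*`-traced weighted `L²` space which is Hilbert-symmetric AND symmetric for the bilinear trace
  pairing commutes with `⋆` (converse of lit ✓`B11Eq88LaplaceH1CurrentSymmetry.tpair_comm_of_isSymmetric_of_starW`).
* §2 ★`hessOpOfRecord_starW` (`Δ(U₀)` real: ✓`hessOpOfRecord_isSymmetric` + ✓`tpair_hessOpOfRecord_comm`); `RRec_sW`, `SRec_sW`, ★`covDerivL2K_ofRecord_starW`,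
  ★`covDivL2K_ofRecord_starW`, `covLaplaceSiteK_ofRecord_starW` (`D`, `D*`, `D*D` real at the record's unitary transporters, real constant `cRec = η⁻¹`).
* §3 `siteFieldIn_starW`, ★`QflatOfRecord_starW` (`Q′♭(f⋆) = (Q′♭f)ᴴ`: restriction to the centres), `QflatOfRecord_starW_eq_zero` (`N(Q′♭)` is `⋆`-invariant),
  ★★`RrOfRecord_QflatOfRecord_starW` (`R(U₀; Q′♭)`, the orthogonal projection onto the `⋆`-invariant `Δ_{U₀}N(Q′♭)`, is real — lit ✓`real_starProjection`).
* §4 (matrix level, any torus `P`, under 35b's guard `SmallBelow … k U₀`): `exists_dIterL_phase_mul_star` (the `U(1)` directions of print's `Q_k(U₀)` right-trivialised at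
  `Ū^k(U₀)` are imaginary scalars — n07-e ✓`iterM_phase_eventually` ∕ ✓`fderiv_phase_of_eventually`), `star_dIterL_lieSU_mul_star` (the `𝔰𝔲(N)` directions give `𝔰𝔲(N)`
  values — n07-w1 ✓`coe_iter_mul_qLin` ∕ ✓`qLin_mem_lieSU`), ★`star_qSkewOp_of_skew` (def-Y's real form `qSkewOp k U₀` preserves skew-Hermitian fields; split
  `𝔲(N) = 𝔰𝔲(N) ⊕ iℝ·1` by ✓`sub_phase_mem_lieSU`), ★★`qCplxOp_star` (print's complexified `Q_k(U₀)` commutes with `ᴴ`).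
* §5 `bondFieldIn_starW`, ★★★`QOfRecord_starW` — def-Y's pinned `Q(U₀) = QOfRecord F N k U₀` IS REAL at every guarded background `SmallBelow (avOfRecord F N K) k U₀`.

HONEST LABELS.  `*`-algebra bookkeeping at the record (anti-unitary involution, unitary transporters, the tree's own calculus of the (0.4) averaging); NO estimate;
`Δ_a`, `G₁`, `(QG₁Q†)⁻¹`, `H₁`, `H♭` in the (115) reading, `C^{𝔰𝔩}` and the (3.134) assembly are the sequel files.  Count-neutral; N07 NOT discharged; P0 ⟨26900⟩ OPEN;
R4 is the conditional finite-𝕋⁴ rung only.  Nothing here is a claim about the Yang–Mills mass gap (`Summit.QuantumFields`): finite torus, fixed `ε`; nothing continuum ∕ OS ∕ Clay.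
-/

set_option autoImplicit false

noncomputable section

open scoped Matrix Matrix.Norms.L2Operator InnerProductSpace ComplexConjugate BigOperators Topology

namespace Summit.QuantumFields.YangMills.Theorems.N07RecordLettersReality

open Filter
open Literature.MathematicalPhysics.QuantumFieldTheory.Balaban1983to89
open Literature.MathematicalPhysics.QuantumFieldTheory.Balaban1983to89.T4Continuum (T4Family)
open T4Continuum BlockAveraging
open B4Sect5Torus (TSite)
open B9SectCLatticeCarrier (Bond)
open B9Eq311L2Pairing (WL2)
open B9Eq311TracePairing (starW equiv_starW apply_equiv_starW starW_starW tpair tpair_comm tpair_eq_inner_starW)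
open B9Eq310HessianOperator (adTransportW adTransportW_apply)
open B9Eq310HessianHermitian (star_val_inv_of_unitary)
open B9Eq33CovDerivVector (covDeriv_apply covDiv_apply)
open B11Eq103H1Complex (SiteL2K BondL2K covDerivL2K covDivL2K covLaplaceSiteK equiv_covDerivL2K equiv_covDivL2K projR RLatticeK)
open B9Eq3119DeltaPiReality (sW_sub sW_smul sW_sum real_comp real_starProjection)
open Node00
open ExpMeanLog (expMeanLogSU deltaSU lt_third_of_lt_deltaSU)
open T4AdjointCovarianceUnitary (lieSU mem_lieSU_iff conj_mem_lieSU toUnitary)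
open Summit.QuantumFields.YangMills.BalabanUVNodes.N07AveragingPhaseEquivariance (iterM_phase_eventually fderiv_phase_of_eventually)
open Summit.QuantumFields.YangMills.BalabanUVNodes.N07LinearisedAveragingKernel (qLin_mem_lieSU)
open Summit.QuantumFields.YangMills.BalabanUVNodes.N07QOfRecordOntoSmallField (sub_phase_mem_lieSU)
open Summit.QuantumFields.YangMills.Theorems.N07QOfRecordFlatOnto (skewField_conjTranspose)
open Summit.QuantumFields.YangMills.Theorems.N07HessOpOfRecordSymmetric (star_coe_unitsOfRecord tauRec_star tauRec_mul_comm hessOpOfRecord_isSymmetric)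
open Summit.QuantumFields.YangMills.Theorems.N07DeltaPiOfRecordPairing (tpair_hessOpOfRecord_comm)

/-! ## §1  Generic: Hilbert-symmetric + transpose-symmetric ⇒ real -/

section Generic

variable {𝔸 : Type*} [Ring 𝔸] [StarRing 𝔸] [Algebra ℂ 𝔸]
  {W : Type*} [NormedAddCommGroup W] [InnerProductSpace ℂ W] (φ : W ≃ₗ[ℂ] 𝔸)
  {ι : Type*} [Fintype ι] {w : ι → ℝ} [Fact (∀ i, 0 < w i)] (τ : 𝔸 →ₗ[ℂ] ℂ)

/-- ★ **HILBERT-SYMMETRIC AND SYMMETRIC FOR THE BILINEAR TRACE PAIRING ⇒ REAL**: `⟪T(f⋆), g⟫ = ⟪f⋆, Tg⟫ = (f, Tg)_τ = (g, Tf)_τ = (Tf, g)_τ = ⟪(Tf)⋆, g⟫`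
(`(f, g)_τ = ⟪f⋆, g⟫`, cyclic trace). [cite: Balaban1985BackgroundPropagators, p.392, (3.11) p.392] -/
theorem real_of_isSymmetric_of_tpair_comm (hφ : ∀ X Y : 𝔸, ⟪φ.symm X, φ.symm Y⟫_ℂ = τ (star X * Y)) (hτ₂ : ∀ X Y : 𝔸, τ (X * Y) = τ (Y * X))
    {T : WL2 ℂ w W →ₗ[ℂ] WL2 ℂ w W} (hT : T.IsSymmetric) (hTt : ∀ x y, tpair φ τ x (T y) = tpair φ τ y (T x)) :
    ∀ f, T (starW φ f) = starW φ (T f) := fun f => by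
  apply ext_inner_right ℂ
  intro g
  rw [hT, ← tpair_eq_inner_starW φ τ hφ, hTt, tpair_comm φ τ hτ₂, tpair_eq_inner_starW φ τ hφ]

end Generic

/-! ## §2  `Δ(U₀)`, `D_{U₀}`, `D*_{U₀}`, `Δ_{U₀}` are real at every background of record -/

section Record

variable (F : T4Family) (N : ℕ) {K : ℕ} (k : ℕ) (U₀ : GaugeField (F.P K) 0 (SU N))

/-- ★ **`Δ(U₀)` OF RECORD IS REAL AT EVERY BACKGROUND**: `Δ(U₀)(A⋆) = (Δ(U₀)A)⋆` — Hilbert-symmetric (✓`hessOpOfRecord_isSymmetric`) and transpose-symmetric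
(✓`tpair_hessOpOfRecord_comm`). [cite: Balaban1985BackgroundPropagators, (3.10) p.392, p.392 («hermitian operator»)] -/
theorem hessOpOfRecord_starW [Fact (0 < c0Rec F K k)]
    (A : BondL2K ℂ (F.P K).d (fun _ => (F.P K).sitesPerDir 0) (c0Rec F K k) (WRec N)) :
    hessOpOfRecord F N k U₀ (starW (phiRec N) A) = starW (phiRec N) (hessOpOfRecord F N k U₀ A) :=
  real_of_isSymmetric_of_tpair_comm (phiRec N) (tauRec N) inner_phiRec_symm (tauRec_mul_comm N) (hessOpOfRecord_isSymmetric F N k U₀)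
    (tpair_hessOpOfRecord_comm F N k U₀) A

/-- `R(U₀(b))` commutes with the fibre involution: `(U X U⁻¹)ᴴ = U Xᴴ U⁻¹` for unitary `U`. [cite: Balaban1985BackgroundPropagators, p.390] -/
theorem RRec_sW (a : Bond (F.P K).d (fun _ => (F.P K).sitesPerDir 0)) (v : WRec N) :
    RRec F N U₀ a ((phiRec N).symm (star (phiRec N v))) = (phiRec N).symm (star (phiRec N (RRec F N U₀ a v))) := by
  have hU := star_coe_unitsOfRecord F N U₀
  rw [RRec, adTransportW_apply, adTransportW_apply]
  simp only [LinearEquiv.apply_symm_apply, star_mul, hU, star_val_inv_of_unitary hU, mul_assoc]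

/-- `R(U₀(b)⁻¹)` commutes with the fibre involution. [cite: Balaban1985BackgroundPropagators, p.390, (3.8) p.392] -/
theorem SRec_sW (a : Bond (F.P K).d (fun _ => (F.P K).sitesPerDir 0)) (v : WRec N) :
    SRec F N U₀ a ((phiRec N).symm (star (phiRec N v))) = (phiRec N).symm (star (phiRec N (SRec F N U₀ a v))) := by
  have hU := star_coe_unitsOfRecord F N U₀
  rw [SRec, adTransportW_apply, adTransportW_apply]
  simp only [LinearEquiv.apply_symm_apply, star_mul, inv_inv, hU, star_val_inv_of_unitary hU, mul_assoc]

/-- The record's constant `cRec = η_k⁻¹` is real. [cite: Balaban1985BackgroundPropagators, (3.3) p.391 (bookkeeping)] -/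
theorem conj_cRec : conj (cRec F K k) = cRec F K k := by
  rw [cRec, map_inv₀, Complex.conj_ofReal]

/-- ★ **`D_{U₀}` OF RECORD IS REAL**: `D(f⋆) = (Df)⋆` (unitary transporters, real `η⁻¹`). [cite: Balaban1985BackgroundPropagators, (3.3) p.391] -/
theorem covDerivL2K_ofRecord_starW [Fact (0 < c0Rec F K k)]
    (f : SiteL2K ℂ (F.P K).d (fun _ => (F.P K).sitesPerDir 0) (c0Rec F K k) (WRec N)) :
    covDerivL2K ℂ (c0Rec F K k) (cRec F K k) (RRec F N U₀) (starW (phiRec N) f) =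
      starW (phiRec N) (covDerivL2K ℂ (c0Rec F K k) (cRec F K k) (RRec F N U₀) f) := by
  apply (WL2.equiv ℂ (fun _ : Bond (F.P K).d (fun _ => (F.P K).sitesPerDir 0) => c0Rec F K k) (WRec N)).injective
  funext b
  rw [equiv_covDerivL2K, equiv_starW, equiv_covDerivL2K, covDeriv_apply, covDeriv_apply, equiv_starW, equiv_starW, RRec_sW, ← sW_sub, sW_smul,
    conj_cRec]

/-- ★ **`D*_{U₀}` OF RECORD IS REAL.** [cite: Balaban1985BackgroundPropagators, (3.8) p.392] -/
theorem covDivL2K_ofRecord_starW [Fact (0 < c0Rec F K k)]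
    (A : BondL2K ℂ (F.P K).d (fun _ => (F.P K).sitesPerDir 0) (c0Rec F K k) (WRec N)) :
    covDivL2K ℂ (c0Rec F K k) (cRec F K k) (SRec F N U₀) (starW (phiRec N) A) =
      starW (phiRec N) (covDivL2K ℂ (c0Rec F K k) (cRec F K k) (SRec F N U₀) A) := by
  apply (WL2.equiv ℂ (fun _ : TSite (F.P K).d (fun _ => (F.P K).sitesPerDir 0) => c0Rec F K k) (WRec N)).injective
  funext x
  rw [equiv_covDivL2K, equiv_starW, equiv_covDivL2K, covDiv_apply, covDiv_apply, sW_smul, conj_cRec, sW_sum]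
  congr 1
  refine Finset.sum_congr rfl fun μ _ => ?_
  rw [equiv_starW, equiv_starW, SRec_sW, sW_sub]

/-- **`Δ_{U₀} = D*D` ON THE SITE FIELDS IS REAL.** [cite: Balaban1985BackgroundPropagators, (3.23) p.394] -/
theorem covLaplaceSiteK_ofRecord_starW [Fact (0 < c0Rec F K k)]
    (f : SiteL2K ℂ (F.P K).d (fun _ => (F.P K).sitesPerDir 0) (c0Rec F K k) (WRec N)) :
    covLaplaceSiteK (cRec F K k) (RRec F N U₀) (SRec F N U₀) (starW (phiRec N) f) =
      starW (phiRec N) (covLaplaceSiteK (cRec F K k) (RRec F N U₀) (SRec F N U₀) f) := by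
  rw [covLaplaceSiteK, LinearMap.comp_apply, LinearMap.comp_apply, covDerivL2K_ofRecord_starW, covDivL2K_ofRecord_starW]

/-! ## §3  `Q′♭` and `R(U₀; Q′♭)` are real -/

/-- The read-in of a site field commutes with `⋆`: `siteFieldIn (f⋆) x = (siteFieldIn f x)ᴴ`. [cite: Balaban1985BackgroundPropagators, (3.11) p.392 (bookkeeping)] -/
theorem siteFieldIn_starW [Fact (0 < c0Rec F K k)]
    (f : SiteL2K ℂ (F.P K).d (fun _ => (F.P K).sitesPerDir 0) (c0Rec F K k) (WRec N)) (x : Site (F.P K) 0) :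
    siteFieldIn F N k (starW (phiRec N) f) x = star (siteFieldIn F N k f x) := by
  rw [siteFieldIn_apply, siteFieldIn_apply, apply_equiv_starW]

/-- ★ **`Q′♭` IS REAL**: `Q′♭(f⋆) = (Q′♭ f)ᴴ` pointwise — restriction to the `k`-centres sees only the values. [cite: Balaban1985Averaging, (11) p.19; Balaban1985BackgroundPropagators, (3.19) p.393] -/
theorem QflatOfRecord_starW [Fact (0 < c0Rec F K k)]
    (f : SiteL2K ℂ (F.P K).d (fun _ => (F.P K).sitesPerDir 0) (c0Rec F K k) (WRec N)) :
    QflatOfRecord F N k (starW (phiRec N) f) = star (QflatOfRecord F N k f) := by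
  funext y
  rw [QflatOfRecord_apply, Pi.star_apply, QflatOfRecord_apply, siteFieldIn_starW]

/-- **`N(Q′♭)` IS `⋆`-INVARIANT.** [cite: Balaban1985BackgroundPropagators, (3.20)–(3.21) p.394] -/
theorem QflatOfRecord_starW_eq_zero [Fact (0 < c0Rec F K k)]
    {f : SiteL2K ℂ (F.P K).d (fun _ => (F.P K).sitesPerDir 0) (c0Rec F K k) (WRec N)} (hf : QflatOfRecord F N k f = 0) :
    QflatOfRecord F N k (starW (phiRec N) f) = 0 := by
  rw [QflatOfRecord_starW, hf, star_zero]

/-- ★★ **`R(U₀; Q′♭)` IS REAL AT EVERY BACKGROUND**: the orthogonal projection onto `Δ_{U₀}N(Q′♭)` commutes with `⋆` — the subspace is `⋆`-invariant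
(`Δ_{U₀}` real, `N(Q′♭)` invariant) and `⋆` is anti-unitary (lit ✓`real_starProjection`). [cite: Balaban1985BackgroundPropagators, (3.21)–(3.23) p.394] -/
theorem RrOfRecord_QflatOfRecord_starW [Fact (0 < c0Rec F K k)]
    (f : SiteL2K ℂ (F.P K).d (fun _ => (F.P K).sitesPerDir 0) (c0Rec F K k) (WRec N)) :
    RrOfRecord F N k U₀ (QflatOfRecord F N k) (starW (phiRec N) f) = starW (phiRec N) (RrOfRecord F N k U₀ (QflatOfRecord F N k) f) := by
  unfold RrOfRecord RLatticeK projR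
  simp only [ContinuousLinearMap.coe_coe]
  refine real_starProjection (phiRec N) (tauRec N) inner_phiRec_symm (tauRec_star N) (tauRec_mul_comm N) _ (fun g hg => ?_) f
  obtain ⟨l, hl, rfl⟩ := Submodule.mem_map.1 hg
  refine Submodule.mem_map.2 ⟨starW (phiRec N) l, ?_, covLaplaceSiteK_ofRecord_starW F N k U₀ l⟩
  rw [LinearMap.mem_ker] at hl ⊢
  exact QflatOfRecord_starW_eq_zero F N k hl

end Record

/-! ## §4  Print's `Q_k(U₀)` is real under the small-field guard -/

section Torus

variable {P : Params} {N : ℕ} [NeZero N]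

/-- **THE U(1) DIRECTIONS OF `Q_k(U₀)` RIGHT-TRIVIALISED AT `Ū^k(U₀)` ARE IMAGINARY SCALARS**: under 35b's guard, for a real phase field `θ` there is a real
`φ` with `Q_k(↑U₀)[b ↦ (iθ_b)·U₀(b)](c) · Ū^k(U₀)(c)⋆ = (iφ_c)·1` (n07-e's ✓`iterM_phase_eventually` + ✓`fderiv_phase_of_eventually`).
[cite: Balaban1985BackgroundPropagators, (3.13)–(3.15) p.393; Balaban1985Variational, (44) p.285; Balaban1987RG1, (0.4) p.253] -/
theorem exists_dIterL_phase_mul_star {U₀ : GaugeField P 0 (SU N)} {k : ℕ}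
    (hSB : SmallBelow (fun j => blockAvg (P := P) (j := j) (expMeanLogSU (n := Fin N))) k U₀) (θ : PBond P 0 → ℝ) :
    ∃ φ : PBond P k → ℝ, ∀ c,
      dIterL k (coeField U₀) (fun b => ((((θ b : ℝ) : ℂ) * Complex.I)) • (U₀ b : Matrix (Fin N) (Fin N) ℂ)) c *
          star ((Averaging.iter (fun j => blockAvg (P := P) (j := j) (expMeanLogSU (n := Fin N))) k U₀ c : SU N) : Matrix (Fin N) (Fin N) ℂ) =
        ((((φ c : ℝ) : ℂ) * Complex.I)) • (1 : Matrix (Fin N) (Fin N) ℂ) := by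
  obtain ⟨φ, hφ⟩ := iterM_phase_eventually (P := P) (N := N) θ k
  have hgU : ∀ j, j < k → ∀ (c : PBond P (j + 1)) (i : Idx P), ‖loopM (iterM j (coeField U₀)) c i - 1‖ ≤ 1 / 3 := by
    intro j hj c i
    rw [← coeField_iter_eq_iterM j (hSB.mono hj.le)]
    exact (lt_third_of_lt_deltaSU (norm_loopM_coeField_sub_one_lt _ c (hSB j hj c) i)).le
  have hU := fderiv_phase_of_eventually (hasFDerivAt_iterM k hSB) (hφ (coeField U₀) hgU)
  refine ⟨φ, fun c => ?_⟩
  have hU' : dIterL k (coeField U₀) (fun b => ((((θ b : ℝ) : ℂ) * Complex.I)) • (U₀ b : Matrix (Fin N) (Fin N) ℂ)) c =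
      ((((φ c : ℝ) : ℂ) * Complex.I)) • iterM k (coeField U₀) c := congrFun hU c
  rw [hU', ← coeField_iter_eq_iterM k hSB, coeField_apply, smul_mul_assoc, coe_mul_star_coe_SU]

/-- **THE `𝔰𝔲(N)` DIRECTIONS OF `Q_k(U₀)` RIGHT-TRIVIALISED AT `Ū^k(U₀)` ARE SKEW-HERMITIAN**: for `X` Lie-algebra valued,
`(Q_k(↑U₀)[b ↦ X_b·U₀(b)](c) · Ū^k(U₀)(c)⋆)⋆ = −(…)` — `X_b U₀(b) = U₀(b)·(U₀(b)⋆X_bU₀(b))`, n07-w1's ✓`coe_iter_mul_qLin` and ✓`qLin_mem_lieSU`.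
[cite: Balaban1985BackgroundPropagators, (3.13)–(3.15) p.393; Balaban1985Variational, (4) p.278, (44) p.285] -/
theorem star_dIterL_lieSU_mul_star {U₀ : GaugeField P 0 (SU N)} {k : ℕ}
    (hSB : SmallBelow (fun j => blockAvg (P := P) (j := j) (expMeanLogSU (n := Fin N))) k U₀) (X : PBond P 0 → lieSU (Fin N)) (c : PBond P k) :
    star (dIterL k (coeField U₀) (fun b => (X b : Matrix (Fin N) (Fin N) ℂ) * (U₀ b : Matrix (Fin N) (Fin N) ℂ)) c *
          star ((Averaging.iter (fun j => blockAvg (P := P) (j := j) (expMeanLogSU (n := Fin N))) k U₀ c : SU N) : Matrix (Fin N) (Fin N) ℂ)) =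
      -(dIterL k (coeField U₀) (fun b => (X b : Matrix (Fin N) (Fin N) ℂ) * (U₀ b : Matrix (Fin N) (Fin N) ℂ)) c *
          star ((Averaging.iter (fun j => blockAvg (P := P) (j := j) (expMeanLogSU (n := Fin N))) k U₀ c : SU N) : Matrix (Fin N) (Fin N) ℂ)) := by
  -- `X_b U₀(b) = U₀(b) Y_b` with `Y_b = U₀(b)⋆ X_b U₀(b) ∈ 𝔰𝔲(N)`
  set Y : PBond P 0 → lieSU (Fin N) := fun b =>
    ⟨((U₀ b)⁻¹ : SU N) * (X b : Matrix (Fin N) (Fin N) ℂ) * star (((U₀ b)⁻¹ : SU N) : Matrix (Fin N) (Fin N) ℂ), by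
      simpa only [T4AdjointCovarianceUnitary.coe_toUnitary] using conj_mem_lieSU (X b).2 (toUnitary (U₀ b)⁻¹)⟩ with hY
  have hdir : (fun b => (X b : Matrix (Fin N) (Fin N) ℂ) * (U₀ b : Matrix (Fin N) (Fin N) ℂ)) =
      fun b => (U₀ b : Matrix (Fin N) (Fin N) ℂ) * (Y b : Matrix (Fin N) (Fin N) ℂ) := by
    funext b
    simp only [hY, coe_inv_SU, star_star]
    rw [← mul_assoc, ← mul_assoc, coe_mul_star_coe_SU, one_mul]
  set V : Matrix (Fin N) (Fin N) ℂ := ((Averaging.iter (fun j => blockAvg (P := P) (j := j) (expMeanLogSU (n := Fin N))) k U₀ c : SU N) : Matrix (Fin N) (Fin N) ℂ)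
    with hV
  rw [hdir, ← coe_iter_mul_qLin hSB Y c, ← hV]
  have hq : star (qLin k U₀ Y c) = -qLin k U₀ Y c := (mem_lieSU_iff.1 (qLin_mem_lieSU hSB Y c)).1
  rw [star_mul, star_mul, star_star, hq]
  simp only [neg_mul, mul_neg, mul_assoc]

/-- ★ **`qSkewOp k U₀` MAPS SKEW-HERMITIAN FIELDS TO SKEW-HERMITIAN FIELDS** under 35b's guard (split `𝔲(N) = 𝔰𝔲(N) ⊕ iℝ·1`, the two lemmas above; `L^{-k}` is real).
[cite: Balaban1985BackgroundPropagators, (3.13)–(3.16) p.393; Balaban1985Variational, (44) p.285] -/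
theorem star_qSkewOp_of_skew {U₀ : GaugeField P 0 (SU N)} {k : ℕ}
    (hSB : SmallBelow (fun j => blockAvg (P := P) (j := j) (expMeanLogSU (n := Fin N))) k U₀)
    {X : PBond P 0 → Matrix (Fin N) (Fin N) ℂ} (hX : ∀ b, star (X b) = -X b) (c : PBond P k) :
    star (qSkewOp k U₀ X c) = -qSkewOp k U₀ X c := by
  -- split `X = X₀ + (iθ)·1`
  set θ : PBond P 0 → ℝ := fun b => (Matrix.trace (X b)).im / N with hθ
  set X₀ : PBond P 0 → lieSU (Fin N) := fun b => ⟨X b - ((((θ b : ℝ) : ℂ) * Complex.I)) • (1 : Matrix (Fin N) (Fin N) ℂ), sub_phase_mem_lieSU (hX b)⟩ with hX₀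
  have hsplit : X = (fun b => (X₀ b : Matrix (Fin N) (Fin N) ℂ)) + fun b => ((((θ b : ℝ) : ℂ) * Complex.I)) • (1 : Matrix (Fin N) (Fin N) ℂ) := by
    funext b; simp [hX₀]
  obtain ⟨φ, hφ⟩ := exists_dIterL_phase_mul_star hSB θ
  have hL : star (((P.L : ℂ) ^ k)⁻¹) = ((P.L : ℂ) ^ k)⁻¹ := by
    rw [Complex.star_def, map_inv₀, map_pow, Complex.conj_natCast]
  set V : Matrix (Fin N) (Fin N) ℂ := ((Averaging.iter (fun j => blockAvg (P := P) (j := j) (expMeanLogSU (n := Fin N))) k U₀ c : SU N) : Matrix (Fin N) (Fin N) ℂ)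
    with hV
  have hlv : leftVel U₀ (fun b => ((((θ b : ℝ) : ℂ) * Complex.I)) • (1 : Matrix (Fin N) (Fin N) ℂ)) =
      fun b => ((((θ b : ℝ) : ℂ) * Complex.I)) • (U₀ b : Matrix (Fin N) (Fin N) ℂ) := by
    funext b
    rw [leftVel_apply, smul_mul_assoc, one_mul]
  have hphase : dIterL k (coeField U₀) (leftVel U₀ fun b => ((((θ b : ℝ) : ℂ) * Complex.I)) • (1 : Matrix (Fin N) (Fin N) ℂ)) c * star V =
      ((((φ c : ℝ) : ℂ) * Complex.I)) • (1 : Matrix (Fin N) (Fin N) ℂ) := by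
    rw [hlv, hV]
    exact hφ c
  have hsu : star (dIterL k (coeField U₀) (leftVel U₀ fun b => (X₀ b : Matrix (Fin N) (Fin N) ℂ)) c * star V) =
      -(dIterL k (coeField U₀) (leftVel U₀ fun b => (X₀ b : Matrix (Fin N) (Fin N) ℂ)) c * star V) := by
    have h := star_dIterL_lieSU_mul_star hSB X₀ c
    rw [← hV] at h
    exact h
  rw [qSkewOp_apply, ← coeField_iter_eq_iterM k hSB, coeField_apply, ← hV]
  rw [show (fun b => X b * (U₀ b : Matrix (Fin N) (Fin N) ℂ)) = leftVel U₀ X from funext fun b => (leftVel_apply U₀ X b).symm]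
  rw [hsplit, map_add, map_add, Pi.add_apply, add_mul, star_smul, star_add, hL, hsu, hphase, smul_add, smul_add]
  rw [star_smul, star_one, Complex.star_def, map_mul, Complex.conj_ofReal, Complex.conj_I, mul_neg, neg_smul, smul_neg, neg_add, smul_neg]

/-- ★★ **PRINT'S COMPLEXIFIED `Q_k(U₀)` IS REAL** under 35b's guard: `Q_k(U₀)(Yᴴ) = (Q_k(U₀)Y)ᴴ` pointwise (the complexification of a real-linear map preserving the
real form `𝔲(N)` commutes with `ᴴ`: `𝔞(Yᴴ) = −𝔞Y`, `𝔞(−iYᴴ) = 𝔞(−iY)`). [cite: Balaban1985BackgroundPropagators, (3.13) p.393, p.393 («extend … to 𝔤ᶜ»)] -/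
theorem qCplxOp_star {U₀ : GaugeField P 0 (SU N)} {k : ℕ}
    (hSB : SmallBelow (fun j => blockAvg (P := P) (j := j) (expMeanLogSU (n := Fin N))) k U₀)
    (Y : PBond P 0 → Matrix (Fin N) (Fin N) ℂ) (c : PBond P k) :
    qCplxOp k U₀ (star Y) c = star (qCplxOp k U₀ Y c) := by
  have h1 : skewField (star Y) = -skewField Y := by
    funext b
    ext i j
    simp [skewField_apply, Matrix.conjTranspose_apply, Matrix.sub_apply, Matrix.smul_apply]
    ring
  have h2 : skewField (-Complex.I • star Y) = skewField (-Complex.I • Y) := by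
    funext b
    ext i j
    simp [skewField_apply, Matrix.conjTranspose_apply, Matrix.sub_apply, Matrix.smul_apply, Complex.conj_I]
    ring
  have hs1 : ∀ b, star (skewField Y b) = -skewField Y b := fun b => by rw [Matrix.star_eq_conjTranspose]; exact skewField_conjTranspose Y b
  have hs2 : ∀ b, star (skewField (-Complex.I • Y) b) = -skewField (-Complex.I • Y) b := fun b => by
    rw [Matrix.star_eq_conjTranspose]; exact skewField_conjTranspose (-Complex.I • Y) b
  unfold qCplxOp
  rw [cplxOp_apply, cplxOp_apply, h1, h2, map_neg]
  simp only [Pi.add_apply, Pi.neg_apply, Pi.smul_apply]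
  rw [star_add, star_smul, star_qSkewOp_of_skew hSB hs1 c, star_qSkewOp_of_skew hSB hs2 c, Complex.star_def, Complex.conj_I]
  simp only [neg_smul, smul_neg, neg_neg]

end Torus

/-! ## §5  def-Y's `Q(U₀) = QOfRecord F N k U₀` is real at every guarded background -/

section RecordQ

variable (F : T4Family) (N : ℕ) [NeZero N] {K : ℕ} (k : ℕ) (U₀ : GaugeField (F.P K) 0 (SU N))

omit [NeZero N] in
/-- The read-in of a bond function commutes with `⋆`. [cite: Balaban1985BackgroundPropagators, (3.11) p.392 (bookkeeping)] -/
theorem bondFieldIn_starW [Fact (0 < c0Rec F K k)]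
    (A : BondL2K ℂ (F.P K).d (fun _ => (F.P K).sitesPerDir 0) (c0Rec F K k) (WRec N)) :
    bondFieldIn F N k (starW (phiRec N) A) = star (bondFieldIn F N k A) := by
  funext b
  rw [bondFieldIn_apply, Pi.star_apply, bondFieldIn_apply, apply_equiv_starW]

/-- ★★★ **def-Y's PINNED AVERAGING `Q(U₀)` IS REAL AT EVERY GUARDED BACKGROUND**: `Q(U₀)(A⋆) = (Q(U₀)A)⋆` under 35b's guard `SmallBelow (avOfRecord F N K) k U₀`
(every member of the small-field class). [cite: Balaban1985BackgroundPropagators, (3.13)–(3.16) p.393; Balaban1985Variational, (44) p.285] -/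
theorem QOfRecord_starW [Fact (0 < c0Rec F K k)] (h : SmallBelow (avOfRecord F N K) k U₀)
    (A : BondL2K ℂ (F.P K).d (fun _ => (F.P K).sitesPerDir 0) (c0Rec F K k) (WRec N)) :
    QOfRecord F N k U₀ (starW (phiRec N) A) = starW (phiRec N) (QOfRecord F N k U₀ A) := by
  apply (WL2.equiv ℂ (wBRec F K k) (WRec N)).injective
  funext c
  rw [QOfRecord_apply, equiv_starW, QOfRecord_apply, bondFieldIn_starW, qCplxOp_star h, LinearEquiv.apply_symm_apply]

end RecordQ

end Summit.QuantumFields.YangMills.Theorems.N07RecordLettersReality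

end
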